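import Summits.CriticalPhenomena.PercolationContinuityZ3.Theorems.PercNearOneGluingNoHeavyLowerTailThreePointProductFormFibreTreeVertexFlat
import HarnessLib

/-!
# (P) on tree-like fibres, V: vertex identities — THE PRODUCT FORM ON TREE STRUCTURES (Sahi programme, prover prim-sahi-p2 gen 59)

Support file (`--supports stmt-CriticalPhenomena-4575`, helper).  Standard axioms, no sorries, no named facts, no definitions.
Memo `run/shared/lean/prim/prim-sahi/FROM-prim-sahi-p2-gen59-ONE-STEP-LEMMA.md` §2, §8(2); `prim-sahi-p2/PROOF-E3.md` (68j), §69.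

**THEOREM (`productForm_of_treeStructure`) — CONJECTURE (P) ON TREE STRUCTURES.**  Let the labels of a finite multigraph carry a TREE STRUCTURE
(`…ThreePointProductFormFibreTreeAssembly`): trunk vertices `T` (none equal to `s, c`), children `ch v` of strictly smaller height, the label
`e u : v — u` to each child, mark labels `Ms v : v — s` and `Mc v : v — c`, the sub-instance masks `mQ v = ⋃_{u ∈ ch v} ({e u} ∪ mQ u) ∪ Ms v ∪ Mc v`,
and private vertex classes `Sv u ∋ u` (terminal-free, parent-free, pairwise disjoint among siblings, containing a private endpoint of every `mQ u`-label,
all of whose endpoints lie in `Sv u ∪ {s,c}`).  Then at every trunk vertex `v`, for the configurations `x = z|_{mQ v}` with restricted flat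
`(♭_v x)|_{mQ v}`:  `#{v|s|c in x, s ↔ c in the flat}² ≤ #{v ↔ s, v ↮ c} · #{v ↔ c, v ↮ s}` — the product form (P) `#bad² ≤ #P1 · #P2`.
This is (P) for every fibre whose trunk `H − {s,c}` is a tree (SIMPLE apex–child labels, any number of parallel marks), e.g. claws, `K_{3,k}`, spiders:
the vertex identities (parts III–IV) feed `productForm_of_treeRecursion_trunk` (the one-step lemma), and `card_bad_add_good`, `card_P1_add_S0`,
`card_P2_add_S0` translate back.  Multiplicities on trunk labels reduce to this by gen 55's two-terminal substitution (R0); not restated here.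
[this work] (gen 59).
-/

namespace Summit.CriticalPhenomena.PercolationContinuityZ3.Theorems.ProductFormFibre

open Finset Literature.Probability.Percolation
open Summit.CriticalPhenomena.PercolationContinuityZ3.Theorems.ThreePointCPIClusterSwap (clusterFlip)

variable {V α : Type*}

section Final

variable [Fintype α] [DecidableEq α] [DecidableEq V] (ends : α → Sym2 V) (s c : V)
  (T : V → Prop) (ch : V → Finset V) (ht : V → ℕ) (mQ : V → α → Bool) (Sv : V → V → Prop) (e : V → α) (Ms Mc : V → Finset α)

open Classical in
/-- **CONJECTURE (P) ON TREE STRUCTURES** (`#bad² ≤ #P1·#P2` at every trunk vertex). [this work] -/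
theorem productForm_of_treeStructure
    (hsc : s ≠ c) (hT : ∀ v, T v → v ≠ s ∧ v ≠ c)
    (hch : ∀ v, T v → ∀ u ∈ ch v, T u ∧ ht u < ht v)
    (he : ∀ v, T v → ∀ u ∈ ch v, ends (e u) = s(v, u))
    (hMs : ∀ v, T v → ∀ m ∈ Ms v, ends m = s(v, s)) (hMc : ∀ v, T v → ∀ m ∈ Mc v, ends m = s(v, c))
    (hmQ : ∀ v, T v → ∀ l, (mQ v l = true ↔ (∃ u ∈ ch v, l = e u ∨ mQ u l = true) ∨ l ∈ Ms v ∨ l ∈ Mc v))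
    (hSv1 : ∀ u, T u → Sv u u)
    (hSv2 : ∀ u, T u → ∀ l, mQ u l = true → (∀ x ∈ ends l, Sv u x ∨ (x = s ∨ x = c)) ∧ (∃ x ∈ ends l, Sv u x))
    (hSv3 : ∀ u, T u → ∀ x, Sv u x → x ≠ s ∧ x ≠ c)
    (hSv4 : ∀ v, T v → ∀ u ∈ ch v, ∀ x, Sv u x → x ≠ v)
    (hSv5 : ∀ v, T v → ∀ u ∈ ch v, ∀ u' ∈ ch v, u ≠ u' → ∀ x, Sv u x → ¬ Sv u' x)
    (v : V) (hv : T v) :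
    (univ.filter fun z : α → Bool =>
        ((¬ (openGraph (labelledOpen ends (fun y => z y && mQ v y))).Reachable v s ∧ ¬ (openGraph (labelledOpen ends (fun y => z y && mQ v y))).Reachable v c ∧
          ¬ (openGraph (labelledOpen ends (fun y => z y && mQ v y))).Reachable s c) ∧
        (openGraph (labelledOpen ends (fun l =>
          clusterFlip ends v (fun y => !(z y && mQ v y)) l && mQ v l))).Reachable s c)).card ^ 2 ≤
    (univ.filter fun z : α → Bool =>
        ((openGraph (labelledOpen ends (fun y => z y && mQ v y))).Reachable v s ∧ ¬ (openGraph (labelledOpen ends (fun y => z y && mQ v y))).Reachable v c)).card *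
    (univ.filter fun z : α → Bool =>
        ((openGraph (labelledOpen ends (fun y => z y && mQ v y))).Reachable v c ∧ ¬ (openGraph (labelledOpen ends (fun y => z y && mQ v y))).Reachable v s)).card := by
  have hch' : ∀ v, T v → ∀ u ∈ ch v, T u := fun v hv u hu => (hch v hv u hu).1
  -- the recursion quantities
  have key := Summit.CriticalPhenomena.PercolationContinuityZ3.Theorems.ProductFormOneStep.productForm_of_treeRecursion_trunk
    T ch ht hch
    (fun w => decide ((Ms w).card ≠ 0)) (fun w => decide ((Mc w).card ≠ 0))
    (fun w => ((univ : Finset (α → Bool)).card : ℝ) ^ (1 + (Ms w).card + (Mc w).card) /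
      (((univ : Finset (α → Bool)).card : ℝ) ^ ((ch w).card + (Ms w).card + (Mc w).card) * 2 ^ ((ch w).card + (Ms w).card + (Mc w).card)))
    (fun w => (2 : ℝ) ^ (Ms w).card) (fun w => (2 : ℝ) ^ (Mc w).card)
    (fun w => ((((univ.filter fun z : α → Bool =>
        ((¬ (openGraph (labelledOpen ends (fun y => z y && mQ w y))).Reachable s w ∧
        ¬ (openGraph (labelledOpen ends (fun y => z y && mQ w y))).Reachable s c) ∧
        (¬ (openGraph (labelledOpen ends (fun y => z y && mQ w y))).Reachable c w ∧
        ¬ (openGraph (labelledOpen ends (fun y => z y && mQ w y))).Reachable c s))).card) : ℕ) : ℝ)) (fun w => ((((univ.filter fun z : α → Bool =>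
        (¬ (openGraph (labelledOpen ends (fun y => z y && mQ w y))).Reachable c w ∧
        ¬ (openGraph (labelledOpen ends (fun y => z y && mQ w y))).Reachable c s)).card) : ℕ) : ℝ)) (fun w => ((((univ.filter fun z : α → Bool =>
        (¬ (openGraph (labelledOpen ends (fun y => z y && mQ w y))).Reachable s w ∧
        ¬ (openGraph (labelledOpen ends (fun y => z y && mQ w y))).Reachable s c)).card) : ℕ) : ℝ)) (fun w => ((((univ.filter fun z : α → Bool =>
        (((¬ (openGraph (labelledOpen ends (fun y => z y && mQ w y))).Reachable s w ∧
        ¬ (openGraph (labelledOpen ends (fun y => z y && mQ w y))).Reachable s c) ∧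
        (¬ (openGraph (labelledOpen ends (fun y => z y && mQ w y))).Reachable c w ∧
        ¬ (openGraph (labelledOpen ends (fun y => z y && mQ w y))).Reachable c s)) ∧
        ¬ (openGraph (labelledOpen ends (fun l =>
          clusterFlip ends w (fun y => !(z y && mQ w y)) l && mQ w l))).Reachable c s)).card) : ℕ) : ℝ))
    (fun w hw => by
      have hU : (0 : ℝ) < ((univ : Finset (α → Bool)).card : ℝ) := by exact_mod_cast Finset.card_pos.mpr Finset.univ_nonempty
      positivity)
    (fun w hw h => by simp only [decide_eq_false_iff_not, not_not] at h; simp [h])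
    (fun w hw h => by
      simp only [decide_eq_true_eq] at h
      obtain ⟨k, hk⟩ := Nat.exists_eq_succ_of_ne_zero h
      rw [hk, pow_succ]
      have : (1 : ℝ) ≤ 2 ^ k := one_le_pow₀ (by norm_num)
      linarith)
    (fun w hw h => by simp only [decide_eq_false_iff_not, not_not] at h; simp [h])
    (fun w hw h => by
      simp only [decide_eq_true_eq] at h
      obtain ⟨k, hk⟩ := Nat.exists_eq_succ_of_ne_zero h
      rw [hk, pow_succ]
      have : (1 : ℝ) ≤ 2 ^ k := one_le_pow₀ (by norm_num)
      linarith)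
    (fun w hw => by
      have h := vertex_S0 ends s c T ch mQ Sv e Ms Mc hsc hT hch' he hMs hMc hmQ hSv1 hSv2 hSv3 hSv4 hSv5 w hw
      rw [h]; simp only [one_pow, one_mul])
    (fun w hw => by
      have h := vertex_isoC ends s c T ch mQ Sv e Ms Mc hsc hT hch' he hMs hMc hmQ hSv1 hSv2 hSv3 hSv4 hSv5 w hw
      rw [h]; simp only [one_pow, mul_one]; ring)
    (fun w hw => by
      have h := vertex_isoS ends s c T ch mQ Sv e Ms Mc hsc hT hch' he hMs hMc hmQ hSv1 hSv2 hSv3 hSv4 hSv5 w hw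
      rw [h]; simp only [one_pow, one_mul]; ring)
    (fun w hw => by
      have hGa := vertex_Ga ends s c T ch mQ Sv e Ms Mc hsc hT hch' he hMs hMc hmQ hSv1 hSv2 hSv3 hSv4 hSv5 w hw
      have hGb := vertex_Gb ends s c T ch mQ Sv e Ms Mc hsc hT hch' he hMs hMc hmQ hSv1 hSv2 hSv3 hSv4 hSv5 w hw
      have hG1 := vertex_G1 ends s c T ch mQ Sv e Ms Mc hsc hT hch' he hMs hMc hmQ hSv1 hSv2 hSv3 hSv4 hSv5 w hw
      have hie := card_good_add_G1 ends s w c (mQ w)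
      have hieR := congrArg (fun n : ℕ => (n : ℝ)) hie
      push_cast at hieR
      have hgood : ((((univ.filter fun z : α → Bool =>
        (((¬ (openGraph (labelledOpen ends (fun y => z y && mQ w y))).Reachable s w ∧
        ¬ (openGraph (labelledOpen ends (fun y => z y && mQ w y))).Reachable s c) ∧
        (¬ (openGraph (labelledOpen ends (fun y => z y && mQ w y))).Reachable c w ∧
        ¬ (openGraph (labelledOpen ends (fun y => z y && mQ w y))).Reachable c s)) ∧
        ¬ (openGraph (labelledOpen ends (fun l =>
          clusterFlip ends w (fun y => !(z y && mQ w y)) l && mQ w l))).Reachable c s)).card) : ℕ) : ℝ) = ((((univ.filter fun z : α → Bool =>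
        (((¬ (openGraph (labelledOpen ends (fun y => z y && mQ w y))).Reachable s w ∧
        ¬ (openGraph (labelledOpen ends (fun y => z y && mQ w y))).Reachable s c) ∧
        (¬ (openGraph (labelledOpen ends (fun y => z y && mQ w y))).Reachable c w ∧
        ¬ (openGraph (labelledOpen ends (fun y => z y && mQ w y))).Reachable c s)) ∧
        (¬ (openGraph (labelledOpen ends (fun l =>
          clusterFlip ends w (fun y => !(z y && mQ w y)) l && mQ w l))).Reachable c w ∧
        ¬ (openGraph (labelledOpen ends (fun l =>
          clusterFlip ends w (fun y => !(z y && mQ w y)) l && mQ w l))).Reachable c s))).card) : ℕ) : ℝ) + ((((univ.filter fun z : α → Bool =>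
        (((¬ (openGraph (labelledOpen ends (fun y => z y && mQ w y))).Reachable s w ∧
        ¬ (openGraph (labelledOpen ends (fun y => z y && mQ w y))).Reachable s c) ∧
        (¬ (openGraph (labelledOpen ends (fun y => z y && mQ w y))).Reachable c w ∧
        ¬ (openGraph (labelledOpen ends (fun y => z y && mQ w y))).Reachable c s)) ∧
        (¬ (openGraph (labelledOpen ends (fun l =>
          clusterFlip ends w (fun y => !(z y && mQ w y)) l && mQ w l))).Reachable s w ∧
        ¬ (openGraph (labelledOpen ends (fun l =>
          clusterFlip ends w (fun y => !(z y && mQ w y)) l && mQ w l))).Reachable s c))).card) : ℕ) : ℝ) - ((((univ.filter fun z : α → Bool =>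
        (((¬ (openGraph (labelledOpen ends (fun y => z y && mQ w y))).Reachable s w ∧
        ¬ (openGraph (labelledOpen ends (fun y => z y && mQ w y))).Reachable s c) ∧
        (¬ (openGraph (labelledOpen ends (fun y => z y && mQ w y))).Reachable c w ∧
        ¬ (openGraph (labelledOpen ends (fun y => z y && mQ w y))).Reachable c s)) ∧
        ((¬ (openGraph (labelledOpen ends (fun l =>
          clusterFlip ends w (fun y => !(z y && mQ w y)) l && mQ w l))).Reachable s w ∧
        ¬ (openGraph (labelledOpen ends (fun l =>
          clusterFlip ends w (fun y => !(z y && mQ w y)) l && mQ w l))).Reachable s c) ∧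
        (¬ (openGraph (labelledOpen ends (fun l =>
          clusterFlip ends w (fun y => !(z y && mQ w y)) l && mQ w l))).Reachable c w ∧
        ¬ (openGraph (labelledOpen ends (fun l =>
          clusterFlip ends w (fun y => !(z y && mQ w y)) l && mQ w l))).Reachable c s)))).card) : ℕ) : ℝ) := by linarith
      rw [hgood, hGa, hGb, hG1]
      rcases Nat.eq_zero_or_pos (Ms w).card with hs0 | hs0 <;> rcases Nat.eq_zero_or_pos (Mc w).card with hc0 | hc0
      · simp [hs0, hc0]; ring
      · simp [hs0, Nat.pos_iff_ne_zero.mp hc0, zero_pow (Nat.pos_iff_ne_zero.mp hc0)]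
      · simp [hc0, Nat.pos_iff_ne_zero.mp hs0, zero_pow (Nat.pos_iff_ne_zero.mp hs0)]
      · simp [Nat.pos_iff_ne_zero.mp hs0, Nat.pos_iff_ne_zero.mp hc0, zero_pow (Nat.pos_iff_ne_zero.mp hs0),
          zero_pow (Nat.pos_iff_ne_zero.mp hc0)])
    v hv
  obtain ⟨-, -, -, -, hP⟩ := key
  -- translate back to (bad, P1, P2)
  have h1 := congrArg (fun n : ℕ => (n : ℝ)) (card_bad_add_good ends s v c (mQ v))
  have h2 := congrArg (fun n : ℕ => (n : ℝ)) (card_P1_add_S0 ends s v c (mQ v))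
  have h3 := congrArg (fun n : ℕ => (n : ℝ)) (card_P2_add_S0 ends s v c (mQ v))
  push_cast at h1 h2 h3
  have hb : (((univ.filter fun z : α → Bool =>
        ((¬ (openGraph (labelledOpen ends (fun y => z y && mQ v y))).Reachable v s ∧ ¬ (openGraph (labelledOpen ends (fun y => z y && mQ v y))).Reachable v c ∧
          ¬ (openGraph (labelledOpen ends (fun y => z y && mQ v y))).Reachable s c) ∧
        (openGraph (labelledOpen ends (fun l =>
          clusterFlip ends v (fun y => !(z y && mQ v y)) l && mQ v l))).Reachable s c)).card : ℕ) : ℝ) = ((((univ.filter fun z : α → Bool =>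
        ((¬ (openGraph (labelledOpen ends (fun y => z y && mQ v y))).Reachable s v ∧
        ¬ (openGraph (labelledOpen ends (fun y => z y && mQ v y))).Reachable s c) ∧
        (¬ (openGraph (labelledOpen ends (fun y => z y && mQ v y))).Reachable c v ∧
        ¬ (openGraph (labelledOpen ends (fun y => z y && mQ v y))).Reachable c s))).card) : ℕ) : ℝ) - ((((univ.filter fun z : α → Bool =>
        (((¬ (openGraph (labelledOpen ends (fun y => z y && mQ v y))).Reachable s v ∧
        ¬ (openGraph (labelledOpen ends (fun y => z y && mQ v y))).Reachable s c) ∧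
        (¬ (openGraph (labelledOpen ends (fun y => z y && mQ v y))).Reachable c v ∧
        ¬ (openGraph (labelledOpen ends (fun y => z y && mQ v y))).Reachable c s)) ∧
        ¬ (openGraph (labelledOpen ends (fun l =>
          clusterFlip ends v (fun y => !(z y && mQ v y)) l && mQ v l))).Reachable c s)).card) : ℕ) : ℝ) := by linarith
  have hp1 : (((univ.filter fun z : α → Bool =>
        ((openGraph (labelledOpen ends (fun y => z y && mQ v y))).Reachable v s ∧ ¬ (openGraph (labelledOpen ends (fun y => z y && mQ v y))).Reachable v c)).card : ℕ) : ℝ) = ((((univ.filter fun z : α → Bool =>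
        (¬ (openGraph (labelledOpen ends (fun y => z y && mQ v y))).Reachable c v ∧
        ¬ (openGraph (labelledOpen ends (fun y => z y && mQ v y))).Reachable c s)).card) : ℕ) : ℝ) - ((((univ.filter fun z : α → Bool =>
        ((¬ (openGraph (labelledOpen ends (fun y => z y && mQ v y))).Reachable s v ∧
        ¬ (openGraph (labelledOpen ends (fun y => z y && mQ v y))).Reachable s c) ∧
        (¬ (openGraph (labelledOpen ends (fun y => z y && mQ v y))).Reachable c v ∧
        ¬ (openGraph (labelledOpen ends (fun y => z y && mQ v y))).Reachable c s))).card) : ℕ) : ℝ) := by linarith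
  have hp2 : (((univ.filter fun z : α → Bool =>
        ((openGraph (labelledOpen ends (fun y => z y && mQ v y))).Reachable v c ∧ ¬ (openGraph (labelledOpen ends (fun y => z y && mQ v y))).Reachable v s)).card : ℕ) : ℝ) = ((((univ.filter fun z : α → Bool =>
        (¬ (openGraph (labelledOpen ends (fun y => z y && mQ v y))).Reachable s v ∧
        ¬ (openGraph (labelledOpen ends (fun y => z y && mQ v y))).Reachable s c)).card) : ℕ) : ℝ) - ((((univ.filter fun z : α → Bool =>
        ((¬ (openGraph (labelledOpen ends (fun y => z y && mQ v y))).Reachable s v ∧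
        ¬ (openGraph (labelledOpen ends (fun y => z y && mQ v y))).Reachable s c) ∧
        (¬ (openGraph (labelledOpen ends (fun y => z y && mQ v y))).Reachable c v ∧
        ¬ (openGraph (labelledOpen ends (fun y => z y && mQ v y))).Reachable c s))).card) : ℕ) : ℝ) := by linarith
  have hfin : (((univ.filter fun z : α → Bool =>
        ((¬ (openGraph (labelledOpen ends (fun y => z y && mQ v y))).Reachable v s ∧ ¬ (openGraph (labelledOpen ends (fun y => z y && mQ v y))).Reachable v c ∧
          ¬ (openGraph (labelledOpen ends (fun y => z y && mQ v y))).Reachable s c) ∧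
        (openGraph (labelledOpen ends (fun l =>
          clusterFlip ends v (fun y => !(z y && mQ v y)) l && mQ v l))).Reachable s c)).card : ℕ) : ℝ) ^ 2 ≤
      (((univ.filter fun z : α → Bool =>
        ((openGraph (labelledOpen ends (fun y => z y && mQ v y))).Reachable v s ∧ ¬ (openGraph (labelledOpen ends (fun y => z y && mQ v y))).Reachable v c)).card : ℕ) : ℝ) *
      (((univ.filter fun z : α → Bool =>
        ((openGraph (labelledOpen ends (fun y => z y && mQ v y))).Reachable v c ∧ ¬ (openGraph (labelledOpen ends (fun y => z y && mQ v y))).Reachable v s)).card : ℕ) : ℝ) := by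
    rw [hb, hp1, hp2]; exact hP
  exact_mod_cast hfin

end Final

end Summit.CriticalPhenomena.PercolationContinuityZ3.Theorems.ProductFormFibre
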